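import Literature.IUT.HodgeTheaters.GlobalFrobenioidsCoricRigidityLawsToyField
import Literature.IUT.HodgeTheaters.GlobalFrobenioidsCoricRigidityOfFixedDivisors
import Literature.IUT.HodgeTheaters.GlobalFrobenioidsInfKappaDeterminesProofs
import HarnessLib

/-!
# [IUTchI] Example 5.1 (v), pp. 127–129 — the Kummer-rigidity LAW SET of the layer-5 certificate row
# `IUTchI:Ex5.1(v)` is JOINTLY SATISFIABLE (non-vacuity witness with NON-ABELIAN `π₁^rat`; proof-only)

S. Mochizuki, *Inter-universal Teichmüller theory I*, kurims manuscript (May 2020), §5 Example 5.1 (v) pp. 127–129: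
"consideration of Kummer classes … yields a natural injection of `†𝕄^⊛_∞κ` into `lim_H H¹(H, μ_Ẑ(†𝕄^⊛_∞κ))`" (p. 127
l. 57–75), "unique … by considering divisors of zeroes and poles [Rmk 3.1.7 (i)] … `ℚ_{>0} ∩ Ẑ^× = {1}`" (p. 127 l. 75 –
p. 128 l. 24), "the `π₁^rat(†𝒟^⊛)`-action … does not factor through `π₁^{κ-sol}`" (p. 127 l. 30–35), "the restriction
of the associated Kummer class to some [or, equivalently, every] subgroup … is a torsion element" (p. 129 l. 5–24)
([IUTchI] Ex 5.1 (v) pp.127–129) [claim: Mochizuki2012, status: disputed] (D-0012 claim key; nothing disputed is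
asserted; no side is taken on [IUTchIII] Cor. 3.12).

Cell abc-iut, sub-DAG `plan/L5/SUBDAG-IUTchI-Ex51.md` (rows E51/L22–L31); layer-5 certificate additive modules
`Conditional/Layer5OfSEx51.lean` (`layer5_held_ex51v`, v0.1) and `Conditional/Layer5OfSV02.lean`
(`layer5_held_ex51v_v2`).  Their Ex 5.1 (v) conjuncts are obtained from LANDED closers
(`NFBridgeRecon.existsUniqueCoricStructure_infκPair_of_fixedDivisors` p431147 / `…_of_divisors`,
`…_infκxPair_of_divisors` p424116, `determinesInfκStructure_infκxPair_of_criterion` p430736,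
`IsCoricStructure.factorsThrough_ratKsolKer` / `not_factorsThrough_ratKsolKer` p413972) under LAW BINDERS over the
interface datum `N : NFBridgeRecon`, a Kummer container `H` with `π₁^rat`- and `Ẑ^×`-actions, Kummer realisations
`κ`, `κx`, an order map `ord` and restriction data `R`.  abc-iut-w5-d110's `NFBridgeRecon.not_laws_of_commutative`
(`GlobalFrobenioidsCoricRigidityLawsCentral.lean`, p432142) showed this law set has NO model with abelian `π₁^rat`.

**This file: the law set HAS a model** (`NFBridgeRecon.exists_recon_coricRigidityLaws`) — so the certificate's
Ex 5.1 (v) block (both versions) is not ex falso.  The witness (label TOY; a finite shadow of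
"`Gal(L̄_C/L_C)` acting on rational functions and their divisors", NOT the arithmetic object; built in
`GlobalFrobenioidsCoricRigidityLawsToyField.lean`): `π₁^rat = π₁(†𝒟^⊛) := S₃` (profinite, discrete; NON-ABELIAN, as
`not_laws_of_commutative` requires); `K^rat := ℚ(x₀,x₁,x₂)` with `S₃` permuting the variables; `𝕄_κ = 𝕄_∞κ := {f₀}`,
`f₀ = x₀+x₁+x₂` (fixed), `𝕄_∞κ× := {f₀, x₀, x₁, x₂}` (the variables = one free orbit of "constants moved by
`π₁^{rat/κ-sol}`"; `solKer := ⊤`, so `π₁^{rat/κ-sol} = S₃`); "points" `X := Fin 3` with `ord_y(f₀) = 1`,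
`ord_y(x_i) = [y = i]` (every member of `S` has only zeroes: `f₀` three, `x_i` one); Kummer container
`H := (Fin 3 → Ẑ)` with `S₃` permuting the points and `Ẑ^× = Aut(Ẑ)` acting diagonally, Kummer map = the DIVISOR
map `κ(f) = (η(ord_y f))_y` (injective on `S`; the partial multiplications are empty since `S·S ∩ S = ∅`);
restriction datum `R`: one index, `res(h) = (h₀/h₁, h₁/h₂) ∈ Ẑ × Ẑ` (torsion exactly on `κ(f₀)`).
At this witness ALL law binders of `layer5_held_ex51v` (v0.1: F-2571 + 9 laws on `N`) and of
`layer5_held_ex51v_v2` (9 laws on `N` incl. the torsion criterion) hold — (a) because the two pairs are RIGID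
(`{f₀} ⊔ S₃/S₂` has no non-trivial equivariant permutation) so `u = 1` serves, (b′) tautologically for the divisor
map, the Rmk 3.1.7 shape laws because all orders are `≥ 0` with `f₀` vanishing at two points, `moves` by the
transposition `(0 1)` on `x₀`.  The cyclotome-comparison binders `C`/`Cf` of the certificate are separate data with
their own toy witnesses (`GlobalFrobenioidsCyclotomeIsoOfIntegralLawsNonVacuity.lean`); the certificate-level
conjunction is assembled in `Summits/ABC/IUTFork/Conditional/Layer5OfSEx51NonVacuity.lean`.
READING (honest framing): a non-vacuity datum for an ASSUMPTION LIST, nothing more — it does not instantiate the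
genuine `NFBridgeRecon` ([AbsTopIII] Thm 1.9 merge) nor the genuine Kummer map (L2 merge, GAP G-w4d056-2), and says
nothing about whether the laws hold THERE.  PROOF-ONLY: no `def`, no `instance`, no new Prop fact.
-/

namespace Literature.IUT.HodgeTheaters

open ProfiniteGrp ProfiniteGrp.ProfiniteCompletion
open Literature.AnabelianGeometry.EtaleTheta Literature.AnabelianGeometry.EtaleTheta.ZHatLevel
open CoricRigidityLawsToy

set_option maxHeartbeats 1600000 in
/-- **Joint satisfiability of the Ex 5.1 (v) Kummer-rigidity law set, with non-abelian `π₁^rat`.**  There are an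
interface datum `N : NFBridgeRecon` (toy: `S₃ ↷ ℚ(x₀,x₁,x₂)`, `𝕄_∞κ = {f₀}`, `𝕄_∞κ× = {f₀,x₀,x₁,x₂}`), a Kummer
container `H = (Fin 3 → Ẑ)` with its two actions, Kummer realisations `κ`, `κx` of the two model pairs (the divisor
map), an order map `ord` on three points and restriction data `R`, such that `π₁^rat` is NON-ABELIAN and EVERY law
binder on these data of the layer-5 certificate rows `layer5_held_ex51v` (v0.1, incl. F-2571) and
`layer5_held_ex51v_v2` holds: (a) Kummer naturality ×2, (b′) divisor transport (three phrasings), the Rmk 3.1.7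
pole laws and two-zeroes witnesses (three phrasings each), `π₁^{rat/κ-sol}` moves an ∞κ×-coric function, and the
torsion criterion in both quantifier forms.  (Label TOY: a shadow, not the arithmetic object.)
([IUTchI] Ex 5.1 (v) pp.127–129) [claim: Mochizuki2012, status: disputed] -/
theorem NFBridgeRecon.exists_recon_coricRigidityLaws :
    ∃ (N : NFBridgeRecon.{0}) (H : Type) (_ : CommGroup H) (_ : MulAction N.piRat H)
      (_ : MulAction (MulAut (completion (GrpCat.of (Multiplicative ℤ)))) H)
      (κ : N.infκPair.KummerRealization H) (κx : N.infκxPair.KummerRealization H)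
      (ord : Fin 3 → N.Krat → ℤ) (R : CriticalRestrictionData N.piRat H),
      -- the witness has NON-ABELIAN `π₁^rat` (cf. `not_laws_of_commutative`)
      (∃ g g' : N.piRat, g * g' ≠ g' * g) ∧
      -- F-2571
      N.MκIsInvariants ∧
      -- (a) Kummer naturality ×2
      (∀ e : CoricPair.Iso N.infκPair N.infκPair,
        ∃ u : MulAut (completion (GrpCat.of (Multiplicative ℤ))),
          ∀ x : N.infκPair.carrier, κ.toFun (e.toEquiv x) = u • κ.toFun x) ∧
      (∀ e : CoricPair.Iso N.infκxPair N.infκxPair,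
        ∃ u : MulAut (completion (GrpCat.of (Multiplicative ℤ))),
          ∀ x : N.infκxPair.carrier, κx.toFun (e.toEquiv x) = u • κx.toFun x) ∧
      -- (b′) divisor transport, fixed phrasing ×2, and the `𝕄_κ` phrasing of v0.1
      (∀ (u : MulAut (completion (GrpCat.of (Multiplicative ℤ)))) (f f' : N.infκPair.carrier),
        (∀ g : N.piRat, g • (f : N.Krat) = f) → (∀ g : N.piRat, g • (f' : N.Krat) = f') →
        κ.toFun f' = u • κ.toFun f → ∀ x : Fin 3, u (eta (ord x f)) = eta (ord x f')) ∧
      (∀ (u : MulAut (completion (GrpCat.of (Multiplicative ℤ)))) (f f' : N.infκxPair.carrier),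
        (∀ g : N.piRat, g • (f : N.Krat) = f) → (∀ g : N.piRat, g • (f' : N.Krat) = f') →
        κx.toFun f' = u • κx.toFun f → ∀ x : Fin 3, u (eta (ord x f)) = eta (ord x f')) ∧
      (∀ (u : MulAut (completion (GrpCat.of (Multiplicative ℤ)))) (f f' : N.infκPair.carrier),
        (f : N.Krat) ∈ N.Mκ → (f' : N.Krat) ∈ N.Mκ → κ.toFun f' = u • κ.toFun f →
        ∀ x : Fin 3, u (eta (ord x f)) = eta (ord x f')) ∧
      -- Rmk 3.1.7 pole laws (×3 phrasings) and two-zeroes witnesses (×3 phrasings)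
      (∀ f' ∈ N.Mκ, ∀ x₁ x₂ : Fin 3, x₁ ≠ x₂ → ¬ (ord x₁ f' < 0 ∧ ord x₂ f' < 0)) ∧
      (∀ f' ∈ N.Minfκx, (∀ g : N.piRat, g • f' = f') →
        ∀ x₁ x₂ : Fin 3, x₁ ≠ x₂ → ¬ (ord x₁ f' < 0 ∧ ord x₂ f' < 0)) ∧
      (∃ f ∈ N.Mκ, ∃ x₁ x₂ : Fin 3, x₁ ≠ x₂ ∧ 0 < ord x₁ f ∧ 0 < ord x₂ f) ∧
      (∃ f ∈ N.Minfκ, (∀ g : N.piRat, g • f = f) ∧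
        ∃ x₁ x₂ : Fin 3, x₁ ≠ x₂ ∧ 0 < ord x₁ f ∧ 0 < ord x₂ f) ∧
      (∃ f ∈ N.Minfκx, (∀ g : N.piRat, g • f = f) ∧
        ∃ x₁ x₂ : Fin 3, x₁ ≠ x₂ ∧ 0 < ord x₁ f ∧ 0 < ord x₂ f) ∧
      -- `π₁^{rat/κ-sol}` moves an ∞κ×-coric function
      (∃ g ∈ N.ratKsolKer, ∃ f ∈ N.Minfκx, g • f ≠ f) ∧
      -- the Rmk 3.1.7 (ii) torsion criterion through `R`, both quantifier forms
      (∀ f : N.infκxPair.carrier,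
        (f : N.Krat) ∈ N.Minfκ ↔ ∃ i : R.Idx, IsOfFinOrder (R.res i (κx.toFun f))) ∧
      (∀ f : N.infκxPair.carrier,
        (f : N.Krat) ∈ N.Minfκ ↔ ∀ i : R.Idx, IsOfFinOrder (R.res i (κx.toFun f))) := by
  classical
  -- the toy field `ℚ(x₀,x₁,x₂)` with `S₃` permuting the variables (`GlobalFrobenioidsCoricRigidityLawsToyField`)
  obtain ⟨K, _, actK, f0, XK, hXK_smulP, hf0_smulP, hXK_inj, hXK_ne_f0, hS_mul, hS_ne_zero, hS_fixedP⟩ :=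
    exists_toyField
  -- the profinite group `S₃` (discrete topology); its underlying type IS `Equiv.Perm (Fin 3)`
  let G0 : ProfiniteGrp.{0} := ProfiniteGrp.ofFiniteGrp (FiniteGrp.of (Equiv.Perm (Fin 3)))
  haveI : DiscreteTopology G0 := ⟨rfl⟩
  letI actKG : MulSemiringAction G0 K := actK
  let toPerm : G0 → Equiv.Perm (Fin 3) := fun σ => σ
  let toG : Equiv.Perm (Fin 3) → G0 := fun σ => σ
  have hXK_smul : ∀ (σ : G0) (i : Fin 3), σ • XK i = XK (toPerm σ i) := fun σ i => hXK_smulP σ i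
  have hf0_smul : ∀ σ : G0, σ • f0 = f0 := fun σ => hf0_smulP σ
  have hS_fixed : ∀ s ∈ insert f0 (Set.range XK), (∀ σ : G0, σ • s = s) → s = f0 :=
    fun s hs h => hS_fixedP s hs (fun σ => h (toG σ))
  -- the interface instance (`𝕄̄^⊛ := K^rat` itself with `const = id`; `solKer = ⊤`; the `Aut` data trivial)
  let N0 : NFBridgeRecon.{0} :=
    { l := 5, piDast := G0, piDcirc := ⊤, Fbar := K, fbarField := inferInstance, fbarAction := actKG,
      isOpen_stabilizer_fbar := fun _ => isOpen_discrete _, piRat := G0,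
      ratToAst := ContinuousMonoidHom.id G0,
      ratToAst_surjective := Function.surjective_id, Krat := K, kratField := inferInstance,
      kratAction := actKG, isOpen_stabilizer_krat := fun _ => isOpen_discrete _,
      const := RingHom.id K,
      const_smul := fun _ _ => rfl,
      Mκ := {f0}, Minfκ := {f0}, Minfκx := insert f0 (Set.range XK),
      mκ_subset := subset_rfl, minfκ_subset := Set.singleton_subset_iff.mpr (Set.mem_insert _ _),
      zero_notMem := hS_ne_zero,
      smul_mem_minfκ := fun σ f hf => by
        have hf' : f = f0 := hf
        rw [hf']
        exact (hf0_smul σ).symm ▸ rfl,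
      smul_mem_minfκx := fun σ f hf => by
        rcases hf with rfl | ⟨i, rfl⟩
        · exact (hf0_smul σ).symm ▸ Set.mem_insert _ _
        · exact (hXK_smul σ i).symm ▸ Set.mem_insert_of_mem _ ⟨_, rfl⟩,
      solKer := ⊤,
      solKer_normal := inferInstance, AutD := PUnit, autGroup := inferInstance, Autε := ⊤, AutSL := ⊤,
      AutSLε := ⊤, autSLε_le := le_rfl, autSLε_le_autε := le_rfl,
      lift := fun _ => ContinuousMulEquiv.refl G0 }
  -- the container `H = (Ẑ)^{points}` with `S₃` permuting the points and `Ẑ^× = Aut(Ẑ)` acting diagonally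
  letI zc : CommGroup (completion (GrpCat.of (Multiplicative ℤ))) :=
    { toGroup := inferInstance, mul_comm := Literature.AnabelianGeometry.AbsoluteAnabelian.ZHatCompletion.mul_comm }
  let H : Type := Fin 3 → completion (GrpCat.of (Multiplicative ℤ))
  letI permG : MulAction G0 (Fin 3) := Equiv.Perm.applyMulAction (Fin 3)
  letI actH : MulAction G0 H := arrowAction
  have hactH : ∀ (σ : G0) (h : H) (y : Fin 3), (σ • h) y = h ((toPerm σ)⁻¹ y) :=
    fun _ _ _ => rfl
  have hactZ : ∀ (u : MulAut (completion (GrpCat.of (Multiplicative ℤ)))) (h : H) (y : Fin 3),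
      (u • h) y = u (h y) := fun _ _ _ => rfl
  -- the order functions and the "divisor" Kummer map
  obtain ⟨ord, hord_f0, hord_X, hord_nn⟩ : ∃ ord : Fin 3 → K → ℤ, (∀ x, ord x f0 = 1) ∧
      (∀ x i, ord x (XK i) = if x = i then 1 else 0) ∧ (∀ x f, 0 ≤ ord x f) := by
    refine ⟨fun x f => if f = f0 then 1 else if f = XK x then 1 else 0, fun x => if_pos rfl,
      fun x i => ?_, fun x f => ?_⟩
    · show (if XK i = f0 then (1 : ℤ) else if XK i = XK x then 1 else 0) = if x = i then 1 else 0
      rw [if_neg (hXK_ne_f0 i)]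
      by_cases h : x = i
      · subst h; rw [if_pos rfl, if_pos rfl]
      · rw [if_neg (fun h' => h (hXK_inj _ _ h').symm), if_neg h]
    · show (0 : ℤ) ≤ if f = f0 then 1 else if f = XK x then 1 else 0
      split_ifs <;> omega
  let κfun : K → H := fun f y => eta (ord y f)
  have hκ_apply : ∀ f y, κfun f y = eta (ord y f) := fun _ _ => rfl
  have hκ_f0 : ∀ y, κfun f0 y = eta 1 := fun y => by rw [hκ_apply, hord_f0]
  have hκ_X : ∀ i y, κfun (XK i) y = eta (if y = i then 1 else 0) := fun i y => by
    rw [hκ_apply, hord_X]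
  -- the product of the three coordinates: `η 3` on `f₀`, `η 1` on the variables, multiplicative
  have hPiS : ∀ s ∈ insert f0 (Set.range XK), ∃ n : ℤ, (n = 1 ∨ n = 3) ∧
      κfun s 0 * κfun s 1 * κfun s 2 = eta n := by
    intro s hs
    rcases hs with rfl | ⟨i, rfl⟩
    · refine ⟨3, Or.inr rfl, ?_⟩
      rw [hκ_f0, hκ_f0, hκ_f0, eta_mul, eta_mul]; rfl
    · refine ⟨1, Or.inl rfl, ?_⟩
      rw [hκ_X, hκ_X, hκ_X]
      fin_cases i <;> simp [eta_zero]
  have hPimul : ∀ h k : H, (h * k) 0 * (h * k) 1 * (h * k) 2 = (h 0 * h 1 * h 2) * (k 0 * k 1 * k 2) := by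
    intro h k
    change (h 0 * k 0) * (h 1 * k 1) * (h 2 * k 2) = _
    ac_rfl
  have hκ_mul_notMem : ∀ a ∈ insert f0 (Set.range XK), ∀ b ∈ insert f0 (Set.range XK),
      ∀ c ∈ insert f0 (Set.range XK), κfun a * κfun b ≠ κfun c := by
    intro a ha b hb c hc habc
    obtain ⟨na, hna, ha'⟩ := hPiS a ha
    obtain ⟨nb, hnb, hb'⟩ := hPiS b hb
    obtain ⟨nc, hnc, hc'⟩ := hPiS c hc
    have h := congrArg (fun h : H => h 0 * h 1 * h 2) habc
    change (κfun a * κfun b) 0 * (κfun a * κfun b) 1 * (κfun a * κfun b) 2 = _ at h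
    rw [hPimul, ha', hb', hc', eta_mul] at h
    have := CyclotomeIsoIntegralLawsToy.eta_injective h
    rcases hna with rfl | rfl <;> rcases hnb with rfl | rfl <;> rcases hnc with rfl | rfl <;> omega
  -- injectivity of the divisor map on `S`
  have hκ_inj : ∀ a ∈ insert f0 (Set.range XK), ∀ b ∈ insert f0 (Set.range XK), κfun a = κfun b → a = b := by
    intro a ha b hb hab
    rcases ha with rfl | ⟨i, rfl⟩ <;> rcases hb with rfl | ⟨j, rfl⟩
    · rfl
    · exfalso
      obtain ⟨k, hk⟩ := fin3_other j
      have h := congrFun hab k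
      rw [hκ_f0, hκ_X, if_neg hk] at h
      exact absurd (CyclotomeIsoIntegralLawsToy.eta_injective h) (by norm_num)
    · exfalso
      obtain ⟨k, hk⟩ := fin3_other i
      have h := congrFun hab k
      rw [hκ_f0, hκ_X, if_neg hk] at h
      exact absurd (CyclotomeIsoIntegralLawsToy.eta_injective h) (by norm_num)
    · have h := congrFun hab i
      rw [hκ_X, hκ_X, if_pos rfl] at h
      by_cases hij : i = j
      · rw [hij]
      · rw [if_neg hij] at h
        exact absurd (CyclotomeIsoIntegralLawsToy.eta_injective h) (by norm_num)
  -- equivariance of the divisor map on `S`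
  have hκ_smul : ∀ (σ : G0), ∀ s ∈ insert f0 (Set.range XK), κfun (σ • s) = σ • κfun s := by
    intro σ s hs
    funext y
    rw [hactH]
    rcases hs with rfl | ⟨i, rfl⟩
    · rw [hf0_smul, hκ_f0, hκ_f0]
    · rw [hXK_smul, hκ_X, hκ_X]
      congr 1
      simp only [Equiv.Perm.inv_eq_iff_eq]
  -- the Kummer realisations of the two model pairs: the divisor map
  have hmem_x : ∀ x : N0.infκxPair.carrier, (x : K) ∈ insert f0 (Set.range XK) := fun x => x.2
  have hmem_κ : ∀ x : N0.infκPair.carrier, (x : K) = f0 := fun x => x.2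
  have hmem_κ' : ∀ x : N0.infκPair.carrier, (x : K) ∈ insert f0 (Set.range XK) := fun x => by
    rw [hmem_κ x]; exact Set.mem_insert _ _
  let κx0 : N0.infκxPair.KummerRealization H :=
    { toFun := fun x => κfun x
      realizes :=
        { injective := fun x y hxy => Subtype.ext (hκ_inj _ (hmem_x x) _ (hmem_x y) hxy)
          dom_eq := by
            ext p
            constructor
            · intro hp
              exact absurd hp (hS_mul _ (hmem_x p.1) _ (hmem_x p.2))
            · rintro ⟨c, hc⟩
              exact absurd hc.symm (hκ_mul_notMem _ (hmem_x p.1) _ (hmem_x p.2) _ (hmem_x c))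
          op_eq := fun p => absurd p.2 (hS_mul _ (hmem_x p.1.1) _ (hmem_x p.1.2)) }
      smul := fun σ x => hκ_smul σ _ (hmem_x x) }
  let κ0 : N0.infκPair.KummerRealization H :=
    { toFun := fun x => κfun x
      realizes :=
        { injective := fun x y _ => Subtype.ext ((hmem_κ x).trans (hmem_κ y).symm)
          dom_eq := by
            ext p
            constructor
            · intro hp
              exact absurd (N0.minfκ_subset hp) (hS_mul _ (hmem_κ' p.1) _ (hmem_κ' p.2))
            · rintro ⟨c, hc⟩
              exact absurd hc.symm (hκ_mul_notMem _ (hmem_κ' p.1) _ (hmem_κ' p.2) _ (hmem_κ' c))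
          op_eq := fun p => absurd (N0.minfκ_subset p.2) (hS_mul _ (hmem_κ' p.1.1) _ (hmem_κ' p.1.2)) }
      smul := fun σ x => hκ_smul σ _ (hmem_κ' x) }
  -- the restriction datum: one index, target `Ẑ × Ẑ`, `h ↦ (h₀/h₁, h₁/h₂)`
  let resHom : H →* completion (GrpCat.of (Multiplicative ℤ)) × completion (GrpCat.of (Multiplicative ℤ)) :=
    { toFun := fun h => (h 0 * (h 1)⁻¹, h 1 * (h 2)⁻¹)
      map_one' := by
        change ((1 : completion (GrpCat.of (Multiplicative ℤ))) * (1 : completion (GrpCat.of (Multiplicative ℤ)))⁻¹,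
          (1 : completion (GrpCat.of (Multiplicative ℤ))) * (1 : completion (GrpCat.of (Multiplicative ℤ)))⁻¹) = 1
        rw [inv_one, mul_one]; rfl
      map_mul' := fun h k => by
        change ((h 0 * k 0) * (h 1 * k 1)⁻¹, (h 1 * k 1) * (h 2 * k 2)⁻¹) =
          (h 0 * (h 1)⁻¹ * (k 0 * (k 1)⁻¹), h 1 * (h 2)⁻¹ * (k 1 * (k 2)⁻¹))
        rw [mul_inv, mul_inv, mul_mul_mul_comm, mul_mul_mul_comm (h 1)] }
  have hres_apply : ∀ h : H, resHom h = (h 0 * (h 1)⁻¹, h 1 * (h 2)⁻¹) := fun _ => rfl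
  have hres_f0 : resHom (κfun f0) = 1 := by
    rw [hres_apply, hκ_f0, hκ_f0, hκ_f0, mul_inv_cancel]; rfl
  have hres_X : ∀ i, ¬ IsOfFinOrder (resHom (κfun (XK i))) := by
    intro i h
    rw [hres_apply, hκ_X, hκ_X, hκ_X] at h
    fin_cases i
    · simp [eta_zero] at h
      exact not_isOfFinOrder_eta_one h.fst
    · simp [eta_zero] at h
      exact not_isOfFinOrder_eta_one h.snd
    · simp [eta_zero] at h
      exact not_isOfFinOrder_eta_one (isOfFinOrder_inv_iff.mp h.snd)
  let R0 : CriticalRestrictionData N0.piRat H :=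
    { Idx := PUnit, subgroup := fun _ => ⊤,
      target := fun _ => completion (GrpCat.of (Multiplicative ℤ)) × completion (GrpCat.of (Multiplicative ℤ)),
      grp := fun _ => inferInstance, res := fun _ => resHom }
  -- (b′) is tautological for the divisor map; all orders are `≥ 0`; `f₀` has two zeroes
  have hbp : ∀ (u : MulAut (completion (GrpCat.of (Multiplicative ℤ)))) (f f' : K),
      κfun f' = u • κfun f → ∀ x : Fin 3, u (eta (ord x f)) = eta (ord x f') :=
    fun u f f' hκ x => (congrFun hκ x).symm
  have hnn : ∀ (f' : K) (x₁ x₂ : Fin 3), x₁ ≠ x₂ → ¬ (ord x₁ f' < 0 ∧ ord x₂ f' < 0) :=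
    fun f' x₁ _ _ h => absurd h.1 (not_lt.mpr (hord_nn _ _))
  have hzz : ∃ x₁ x₂ : Fin 3, x₁ ≠ x₂ ∧ 0 < ord x₁ f0 ∧ 0 < ord x₂ f0 :=
    ⟨0, 1, by decide, by rw [hord_f0]; exact one_pos, by rw [hord_f0]; exact one_pos⟩
  -- ASSEMBLY
  refine ⟨N0, H, inferInstance, actH, inferInstance, κ0, κx0, ord, R0, ?_, ?_, ?_, ?_,
    fun u f f' _ _ hκ => hbp u f f' hκ, fun u f f' _ _ hκ => hbp u f f' hκ, fun u f f' _ _ hκ => hbp u f f' hκ,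
    fun f' _ => hnn f', fun f' _ _ => hnn f', ⟨f0, rfl, hzz⟩, ⟨f0, rfl, hf0_smul, hzz⟩,
    ⟨f0, Set.mem_insert _ _, hf0_smul, hzz⟩, ?_, ?_, ?_⟩
  · -- non-abelian `π₁^rat`
    refine ⟨(Equiv.swap 0 1 : Equiv.Perm (Fin 3)), (Equiv.swap 1 2 : Equiv.Perm (Fin 3)), fun h => ?_⟩
    exact absurd (show (Equiv.swap 0 1 : Equiv.Perm (Fin 3)) * Equiv.swap 1 2 =
      Equiv.swap 1 2 * Equiv.swap 0 1 from h) (by decide)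
  · -- F-2571 `MκIsInvariants`
    refine ⟨Set.ext fun f => ⟨fun hf => ⟨hf, fun σ => ?_⟩, fun hf => hf.1⟩⟩
    rw [show f = f0 from hf]
    exact hf0_smul σ
  · -- (a), ∞κ-pair: the carrier is `{f₀}`, every automorphism is the identity
    intro e
    refine ⟨1, fun x => ?_⟩
    rw [one_smul]
    have hx : e.toEquiv x = x := Subtype.ext ((hmem_κ _).trans (hmem_κ x).symm)
    rw [hx]
  · -- (a), ∞κ×-pair: `{f₀} ⊔ {x₀,x₁,x₂}` has no non-trivial `S₃`-equivariant permutation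
    intro e
    refine ⟨1, fun x => ?_⟩
    rw [one_smul]
    suffices key : ∀ x : N0.infκxPair.carrier, e.toEquiv x = x by rw [key]
    have hfix1 : ∀ (x : N0.infκxPair.carrier) (σ : G0), σ • x = x → σ • e.toEquiv x = e.toEquiv x := by
      intro x σ hx
      rw [← e.smul σ x, hx]
    let x0 : N0.infκxPair.carrier := ⟨f0, Set.mem_insert _ _⟩
    have hx0fix : ∀ σ : G0, σ • x0 = x0 := fun σ => Subtype.ext (hf0_smul σ)
    have hex0 : e.toEquiv x0 = x0 :=
      Subtype.ext (hS_fixed _ (hmem_x _) (fun σ => congrArg Subtype.val (hfix1 x0 σ (hx0fix σ))))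
    intro x
    rcases hmem_x x with hx | ⟨i, hx⟩
    · have hxx0 : x = x0 := Subtype.ext hx
      rw [hxx0, hex0]
    · rcases hmem_x (e.toEquiv x) with hy | ⟨j, hy⟩
      · exfalso
        have h1 : e.toEquiv x = e.toEquiv x0 := by rw [hex0]; exact Subtype.ext hy
        have h2 : x = x0 := e.toEquiv.injective h1
        exact hXK_ne_f0 i (hx.trans (congrArg Subtype.val h2))
      · have hji : j = i := by
          by_contra hji
          obtain ⟨k, hki, hkj⟩ := fin3_third i j hji
          have hτx : toG (Equiv.swap j k) • x = x := by
            apply Subtype.ext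
            change toG (Equiv.swap j k) • (x : K) = x
            rw [← hx, hXK_smul]
            change XK ((Equiv.swap j k) i) = XK i
            rw [Equiv.swap_apply_of_ne_of_ne (Ne.symm hji) hki.symm]
          have h2 := congrArg Subtype.val (hfix1 x _ hτx)
          change toG (Equiv.swap j k) • ((e.toEquiv x : N0.infκxPair.carrier) : K) = _ at h2
          rw [← hy, hXK_smul] at h2
          have h3 := hXK_inj _ _ h2
          change (Equiv.swap j k) j = j at h3
          rw [Equiv.swap_apply_left] at h3
          exact hkj h3
        apply Subtype.ext
        rw [← hy, ← hx, hji]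
  · -- `π₁^{rat/κ-sol} = S₃` (the action on `𝕄_∞κ = {f₀}` is trivial, `solKer = ⊤`) moves `x₀`
    refine ⟨(Equiv.swap 0 1 : Equiv.Perm (Fin 3)), ?_, XK 0, Set.mem_insert_of_mem _ ⟨0, rfl⟩, ?_⟩
    · change _ ∈ N0.actionKer ⊓ _
      refine ⟨fun f hf => ?_, Subgroup.mem_top _⟩
      rw [show f = f0 from hf]
      exact hf0_smul _
    · intro h
      have h' : XK (toPerm (Equiv.swap 0 1 : Equiv.Perm (Fin 3)) 0) = XK 0 := (hXK_smul _ 0).symm.trans h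
      have h'' := hXK_inj _ _ h'
      change (Equiv.swap (0 : Fin 3) 1) 0 = 0 at h''
      exact absurd h'' (by decide)
  · -- torsion criterion, "some" form
    intro f
    rcases hmem_x f with hf | ⟨i, hf⟩
    · refine ⟨fun _ => ⟨PUnit.unit, ?_⟩, fun _ => hf⟩
      change IsOfFinOrder (resHom (κfun f))
      rw [hf, hres_f0]; exact IsOfFinOrder.one
    · constructor
      · intro h
        exact absurd (hf.trans (show (f : K) = f0 from h)) (hXK_ne_f0 i)
      · rintro ⟨_, h⟩
        exfalso
        change IsOfFinOrder (resHom (κfun f)) at h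
        rw [← hf] at h
        exact hres_X i h
  · -- torsion criterion, "every" form
    intro f
    rcases hmem_x f with hf | ⟨i, hf⟩
    · refine ⟨fun _ _ => ?_, fun _ => hf⟩
      change IsOfFinOrder (resHom (κfun f))
      rw [hf, hres_f0]; exact IsOfFinOrder.one
    · constructor
      · intro h
        exact absurd (hf.trans (show (f : K) = f0 from h)) (hXK_ne_f0 i)
      · intro h
        exfalso
        have h' := h PUnit.unit
        change IsOfFinOrder (resHom (κfun f)) at h'
        rw [← hf] at h'
        exact hres_X i h'

end Literature.IUT.HodgeTheaters
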